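import Summits.Langlands.Langlands.Theses.OrdinaryPrimeTransport
import Literature.NumberTheory.DiophantineGeometry.BcgpResiduallyA5bModular
import Literature.NumberTheory.Automorphic.IsAutomorphicAE
import Literature.NumberTheory.Automorphic.FreitasLeHungSiksekAbelianVariety
import HarnessLib

/-!
# F4 `_onpath` — `Langlands → GL2TypeSurfaceRealQuadratic` and `E → GL2TypeSurfaceRealQuadratic` (line `GL2TypeSurfaceRealQuadratic`,
crux `ReciprocityUpToIrreducibility`, item stmt-Langlands-14328; G4 ladder-down generation 27)

The rung (and every member `GL2TypeModularRealQuadratic g`) is a CONSEQUENCE of the summit and of the top E (here E is named through its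
`Iff.rfl`-equal copy in route `OrdinaryPrimeTransport`, the module the crux-workfile farm path serves): from `Langlands K`
take a reciprocity datum `Rec` and clause (B) at `n = 2`; the member's hypotheses on `ρ` (irreducible, a.e. unramified, de Rham
for `fontainePstAdicCompletion` = `Rec.pst` definitionally) give `IsGeometricFramed Rec ρ`, and the first conjunct of
`Corresponds Rec ι π.1 ρ` is the a.e. Satake clause `SatakeFrobCompatibleAE ι π.1 ρ`; the abelian-variety hypotheses are not
used.  `GL2TypeSurfaceRealQuadratic_of_Langlands` carries `@[aesop safe apply]` (the tribunal's on-path test closes by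
`intro h; aesop`).  No `sorry`.
-/

noncomputable section

set_option linter.dupNamespace false

open scoped MatrixGroups Matrix NumberField Classical
open Filter IsDedekindDomain IsDedekindDomain.HeightOneSpectrum CategoryTheory
open Literature.NumberTheory.Automorphic Literature.NumberTheory.GaloisRepresentations
open Literature.NumberTheory.PAdicHodge Literature.NumberTheory.DiophantineGeometry
open Literature.AlgebraicGeometry.Motives (AbelianVariety)
open NumberField
open Summit.Langlands

namespace Summit.Langlands.Langlands.Cruxes.ReciprocityUpToIrreducibility.GL2TypeSurfaceRealQuadratic

/-! ## 0. The floor fact = `Literature.NumberTheory.Automorphic.fls2015_modular_abelianVariety_dimOne_realQuadratic`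
(FLS 2015 Thm. 1 in abelian-variety / `GL₂` a.e.-Satake form; vendored p205662, commit 2a50369dd387). -/

/-! ## 1. Vocabulary: framed duals of Tate modules, GL₂-type, Frobenius-factor, the family -/

/-- `r` is the framed dual of `V_ℓ(A)` in the dual basis of `b` (verbatim the clause of the BCGP / FLS facts):
`r(γ) = [γ⁻¹]_bᵀ`, i.e. `H¹_ét(A_{K̄}, ℚ_ℓ) ⊗ ℚ̄_ℓ` framed. -/
def IsFramedDualTate {K : Type} [Field K] [NumberField K] (A : AbelianVariety K) (ℓ : ℕ) [Fact ℓ.Prime]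
    {m : ℕ} (b : Module.Basis (Fin m) ℚ_[ℓ] (A.rationalTateModule ℓ))
    (r : FramedGaloisRep K (PadicAlgCl ℓ) m) : Prop :=
  ∀ g : Field.absoluteGaloisGroup K,
    (r g).val = ((LinearMap.toMatrix b b (A.rationalTateRep ℓ g⁻¹)).map (algebraMap ℚ_[ℓ] (PadicAlgCl ℓ))).transpose

/-- **`A` is of GL₂-type** (Ribet): a number field `E` with `[E:ℚ] = dim A` acts on `A` by `K`-rational
endomorphisms (`E →+* End⁰(A) = A.endAlgebra`). At `dim A = 1` take `E = ℚ`. -/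
def IsGL2Type {K : Type} [Field K] (A : AbelianVariety K) : Prop :=
  ∃ (E : Type) (_ : Field E) (_ : NumberField E), Module.finrank ℚ E = A.dim ∧ Nonempty (E →+* A.endAlgebra)

/-- **`ρ` is an a.e. Frobenius factor of `r`**: at all but finitely many places, the characteristic polynomial of
every arithmetic Frobenius under `ρ` divides the one under `r` (for `ρ = ρ_{A,λ}^∨` a `λ`-adic constituent of
`H¹(A) ⊗ ℚ̄_ℓ` this holds at every good place). -/
def IsFrobFactorAE {K : Type} [Field K] [NumberField K] {ℓ : ℕ} [Fact ℓ.Prime] {n m : ℕ}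
    (ρ : FramedGaloisRep K (PadicAlgCl ℓ) n) (r : FramedGaloisRep K (PadicAlgCl ℓ) m) : Prop :=
  ∀ᶠ v : HeightOneSpectrum (𝓞 K) in cofinite, ∀ 𝔓 ∈ v.primesAbove, ∀ σ : Field.absoluteGaloisGroup K,
    IsArithFrobAt (𝓞 K) σ 𝔓 → FramedRep.charpoly ρ σ ∣ FramedRep.charpoly r σ

/-- **THE RUNG FAMILY, dial = `g = dim A = [E:ℚ]`.**  For every real quadratic field `K`, every GL₂-type abelian
variety `A/K` of dimension `g`, every prime `ℓ`, framed dual `r` of `V_ℓ(A)` and every irreducible, a.e.-unramified,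
de Rham (for Fontaine's pinned datum) `2`-dimensional `ρ : Γ_K → GL₂(ℚ̄_ℓ)` which is an a.e. Frobenius factor of `r`,
`ρ` is automorphic in the summit's a.e.-Satake form: some automorphic `π` of `GL₂(𝔸_K)` has Satake parameters matching
`det(X − ρ(Frob_v))` at almost all `v`. -/
def GL2TypeModularRealQuadratic (g : ℕ) : Prop :=
  ∀ (K : Type) [Field K] [NumberField K] [IsTotallyReal K], Module.finrank ℚ K = 2 →
    ∀ (A : AbelianVariety K), A.dim = g → IsGL2Type A →
      ∀ (ℓ : ℕ) [Fact ℓ.Prime] (b : Module.Basis (Fin (2 * g)) ℚ_[ℓ] (A.rationalTateModule ℓ))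
        (r : FramedGaloisRep K (PadicAlgCl ℓ) (2 * g)), IsFramedDualTate A ℓ b r →
        ∀ ρ : FramedGaloisRep K (PadicAlgCl ℓ) 2, ρ.toGaloisRep.IsIrreducible →
          (∀ᶠ v : HeightOneSpectrum (𝓞 K) in cofinite, ρ.IsUnramifiedAt v) →
          (∀ (w : HeightOneSpectrum (𝓞 K)) (hw : ((ℓ : ℕ) : 𝓞 K) ∈ w.asIdeal),
              (fontainePstAdicCompletion w ℓ hw).IsDeRhamFramed (ρ.toLocal w)) →
          IsFrobFactorAE ρ r →
          ∀ (hcpt : isCompact_glFiniteIntegralLevel 2 K) (ι : PadicAlgCl ℓ ≃+* ℂ),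
            ∃ π : AutomorphicRepData (AutomorphyDatum.gl 2 K hcpt), SatakeFrobCompatibleAE ι π ρ

/-- **THE RUNG (θ29 = 2)**: GL₂-type abelian SURFACES over real quadratic fields. -/
def GL2TypeSurfaceRealQuadratic : Prop := GL2TypeModularRealQuadratic 2

/-- **Above the rung (θ29 ≥ 3)**: GL₂-type abelian varieties of every dimension `≥ 3` over real quadratic fields. -/
def GL2TypeHigherRealQuadratic : Prop := ∀ g : ℕ, 3 ≤ g → GL2TypeModularRealQuadratic g

/-! ## On-path lemmas -/


/-- `E → GL2TypeModularRealQuadratic g` for every `g`. -/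
theorem gl2TypeModular_of_top (g : ℕ)
    (hE : Summit.Langlands.Langlands.Theses.OrdinaryPrimeTransport.ReciprocityUpToIrreducibility) :
    GL2TypeModularRealQuadratic g := by
  intro K _ _ _ _hK A _hdim _hGL ℓ _ b r _hfr ρ hirr hunr hdR _hfac hcpt ι
  obtain ⟨Rec, hall⟩ := hE K
  have hB : GaloisToAutomorphic 2 Rec hcpt := (hall 2 (by norm_num) hcpt).2
  have hgeo : IsGeometricFramed Rec ρ := ⟨hunr, fun w hw => hdR w hw⟩
  obtain ⟨π, _hLalg, hcorr⟩ := hB ℓ ι ρ hirr hgeo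
  exact ⟨π.1, hcorr.1⟩

/-- `E → rung`. -/
theorem GL2TypeSurfaceRealQuadratic_of_top
    (hE : Summit.Langlands.Langlands.Theses.OrdinaryPrimeTransport.ReciprocityUpToIrreducibility) :
    GL2TypeSurfaceRealQuadratic :=
  gl2TypeModular_of_top 2 hE

/-- `Langlands → GL2TypeModularRealQuadratic g` for every `g` (the F4 on-path lemma). -/
theorem gl2TypeModular_of_langlands (g : ℕ) (hL : _root_.Langlands) : GL2TypeModularRealQuadratic g := by
  intro K _ _ _ _hK A _hdim _hGL ℓ _ b r _hfr ρ hirr hunr hdR _hfac hcpt ι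
  obtain ⟨⟨Rec⟩, hall⟩ := hL K
  have hB : GaloisToAutomorphic 2 Rec hcpt := (hall Rec 2 (by norm_num) hcpt).2
  have hgeo : IsGeometricFramed Rec ρ := ⟨hunr, fun w hw => hdR w hw⟩
  obtain ⟨π, _hLalg, hcorr⟩ := hB ℓ ι ρ hirr hgeo
  exact ⟨π.1, hcorr.1⟩

/-- **F4 on-path lemma**: `S → Rung`. -/
@[aesop safe apply]
theorem GL2TypeSurfaceRealQuadratic_of_Langlands (hL : _root_.Langlands) : GL2TypeSurfaceRealQuadratic :=
  gl2TypeModular_of_langlands 2 hL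

end Summit.Langlands.Langlands.Cruxes.ReciprocityUpToIrreducibility.GL2TypeSurfaceRealQuadratic

end
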